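import Summits.Parity.GeneralizedHardyLittlewood.Theses.LeeYangFibres
import Summits.Parity.GeneralizedHardyLittlewood.Theorems.LeeYangFibresPrimeCellsRelativeLocator
import Summits.Parity.GeneralizedHardyLittlewood.Theorems.LeeYangFibresPrimeCellsRelativeHardyLittlewoodDictionary
import Summits.Parity.GeneralizedHardyLittlewood.Theorems.LeeYangFibresPrimeCellsRelativeHardyLittlewoodTools
import Literature.NumberTheory.Sieve.HardyLittlewoodLowRankProofs
import Literature.NumberTheory.Sieve.LinearEquationsInPrimesCount
import Literature.NumberTheory.LFunctions.RHWave0PNTProofs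
import HarnessLib

/-!
# `PrimeCellsRelative` implies the Hardy–Littlewood prime `k`-tuples conjecture (crux stmt-Parity-14112)

Hardness certificate for the crux `PrimeCellsRelative` of route `LeeYangFibres`
(Parity / GeneralizedHardyLittlewood, line `Sketch`): the crux implies the tree's registered open
conjecture `Literature.NumberTheory.Sieve.HardyLittlewoodTuples` (parity.S01, Hardy–Littlewood 1923,
Theorem X 1: `π_H(x) ∼ 𝔖(H) x / log^k x` for every admissible `H`, `k = #H`), hence so do
`RelativeDimOne` (stmt-Parity-14113), `DimOne` (stmt-Parity-0819) and the summit conjunct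
`GeneralizedHardyLittlewood` (Green–Tao Conj. 1.2); also in the `Li_k` form
(`HardyLittlewoodTuplesLi`).

Proof. Rank `≤ 1` is the prime number theorem (`hardyLittlewoodTuples_of_card_le_one` with the
tree's `primeCounting_isEquivalent_holds`). For `k ≥ 1` apply the crux to the translate system
`ψⱼ(n) = n + hⱼ` on `K = [1, x]` (dictionary `…HardyLittlewoodDictionary`: non-degenerate,
`∏_p β_p = 𝔖(H)`, `x - O_H(1) ≤ β_∞ ≤ x`, prime-point count `= π_H(x)`); the cell count differs from
the prime-point count by `≤ k (2 x^{1/u} + 1)` (`Theorems.LeeYangFibresCells`), the prime number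
theorem window gives `(A₁(x) log x / x)^k = 1 + o(1)` (`roughDensity_window`,
`exists_eta_pow_near_one`), `log^{k+1} x = o(√x)` kills the error count
(`errCount_mul_log_pow_le`), and `hl_arith` assembles `|π_H(x) - 𝔖 x/log^k x| ≤ δ 𝔖 x/log^k x`
for every `δ > 0`, with the crux taken at precision `ε = min(1/2, δ𝔖/(8(2𝔖+1)))` (`𝔖(H) > 0` by
admissibility, `singularSeries_pos_iff_holds`).

References: G. H. Hardy, J. E. Littlewood, Acta Math. 44 (1923), Theorem X 1 p. 61
[HardyLittlewood1923]; B. Green, T. Tao, Ann. of Math. 171 (2010), Conj. 1.2 / 1.4 [GreenTao2010];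
H. L. Montgomery, R. C. Vaughan, *Multiplicative Number Theory I*, §8.1 [MontgomeryVaughan2007].
-/

noncomputable section

namespace Summit.Parity.GeneralizedHardyLittlewood.Cruxes.PrimeCellsRelative.Sketch

open scoped BigOperators Topology Classical
open Filter Finset Asymptotics Literature.NumberTheory.Sieve
open Summit.Parity.GeneralizedHardyLittlewood.Theses.LeeYangFibres
open Summit.Parity.GeneralizedHardyLittlewood.Theorems.LeeYangFibresCells

/-- **Hardness certificate: `PrimeCellsRelative → HardyLittlewoodTuples`** (parity.S01, the
Hardy–Littlewood prime `k`-tuples conjecture, registered open in the tree). For an admissible `H`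
(rank `≤ 1` is the prime number theorem, `hardyLittlewoodTuples_of_card_le_one`), apply the crux to
the translate system `(n + hⱼ)ⱼ` on `K = [1, x]`: by the dictionary
(`…HardyLittlewoodDictionary`) its singular product is `𝔖(H) > 0`, `x - O_H(1) ≤ β_∞ ≤ x`, and its
prime-point count is `π_H(x)`, which the cell count approximates within `k (2 x^{1/u} + 1)`
(`Theorems.LeeYangFibresCells`); the prime number theorem window turns `(A₁(x)/x)^k` into
`(1 + o(1))/log^k x`, and `hl_arith` assembles `π_H(x) = (1 + O(δ)) 𝔖(H) x / log^k x`.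
Registered helper of crux stmt-Parity-14112 (line `Sketch`).
[cite: HardyLittlewoodPN3, Theorem X 1 p. 61; GreenTao2010, Conj. 1.4] -/
theorem primeCellsRelative_implies_hardyLittlewoodTuples (hP : PrimeCellsRelative) :
    HardyLittlewoodTuples := by
  intro H hH
  rcases Nat.lt_or_ge H.card 1 with h0 | hk
  · exact hardyLittlewoodTuples_of_card_le_one
      Literature.NumberTheory.LFunctions.primeCounting_isEquivalent_holds (by omega)
  have hs : 0 < singularSeries H := (singularSeries_pos_iff_holds H).mpr hH
  set s := singularSeries H with hsdef
  rw [Asymptotics.IsEquivalent, Asymptotics.isLittleO_iff]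
  intro δ₀ hδ₀
  -- work at precision `δ = min δ₀ 1`
  set δ : ℝ := min δ₀ 1 with hδdef
  have hδ : 0 < δ := lt_min hδ₀ one_pos
  have hδ1 : δ ≤ 1 := min_le_right _ _
  have hδδ₀ : δ ≤ δ₀ := min_le_left _ _
  -- parameters
  obtain ⟨η, hη0, hη12, hηup, hηlo⟩ := exists_eta_pow_near_one H.card (by positivity : 0 < δ / 8)
  set T : ℕ := H.sup Int.natAbs with hTdef
  have hT : ∀ j : Fin H.card, (((H.equivFin.symm j : H) : ℤ)).natAbs ≤ T := fun j =>
    Finset.le_sup (f := Int.natAbs) (H.equivFin.symm j).2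
  set ε : ℝ := min (1 / 2) (δ / 8 * s / (2 * s + 1)) with hεdef
  have hε0 : 0 < ε := lt_min (by norm_num) (by positivity)
  have hε2 : ε * (2 * s + 1) ≤ δ / 8 * s := by
    have := min_le_right (1 / 2 : ℝ) (δ / 8 * s / (2 * s + 1))
    rw [← hεdef, le_div_iff₀ (by positivity)] at this
    exact this
  set c : ℝ := δ * s / (24 * H.card) with hcdef
  have hk0 : (0 : ℝ) < H.card := by exact_mod_cast hk
  have hc : 0 < c := by positivity
  obtain ⟨u, hu, N₀, hN₀⟩ := hP H.card (H.card + H.card * T) hk ε hε0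
  -- thresholds
  have hwin := eventually_primeCounting_window hη0
  have hgrow := eventually_log_growth H.card 1 hη0 hc hc
  filter_upwards [hwin, hgrow, eventually_ge_atTop N₀, eventually_ge_atTop (T + 1),
    eventually_ge_atTop ⌈8 * ((T : ℝ) + 1) / δ⌉₊] with x hxwin hxgr hx₀ hxT hxT'
  obtain ⟨hlog1, -, -, hlogk⟩ := hxgr
  have hx1 : 1 ≤ x := le_trans (by omega) hxT
  have hx1' : (1 : ℝ) ≤ x := by exact_mod_cast hx1
  have hx0' : (0 : ℝ) < x := by linarith
  have hlog : 0 < Real.log x := by linarith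
  have hTx : ((T : ℝ) + 1) ≤ δ / 8 * x := by
    have h8 := (Nat.ceil_le).mp hxT'
    rw [div_le_iff₀ hδ] at h8
    linarith
  -- the translate system and its dictionary
  have hnd := isNondegenerateSystem_shift (fun j : Fin H.card => ((H.equivFin.symm j : H) : ℤ))
    (fun j j' hjj' => H.equivFin.symm.injective (Subtype.ext hjj'))
  have haff := affLinSize_shift_le (fun j : Fin H.card => ((H.equivFin.symm j : H) : ℤ)) hT hx1
  have hsing := singularProduct_shift_eq_singularSeries H
  have hcount := primeTupleCount_eq_primePointCount H x
  obtain ⟨hβ1, hβ2⟩ := archFactor_shift_bounds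
    (fun j : Fin H.card => ((H.equivFin.symm j : H) : ℤ)) hT hxT
  set Ψ : Fin H.card → AffLinForm 1 :=
    fun j => (⟨fun _ => (1 : ℤ), ((H.equivFin.symm j : H) : ℤ)⟩ : AffLinForm 1) with hΨ
  set K : Set (Fin 1 → ℝ) := Set.Icc (fun _ : Fin 1 => (1 : ℝ)) (fun _ => (x : ℝ)) with hK
  have hKc : Convex ℝ K := convex_Icc _ _
  have hKB : K ⊆ realBox 1 x := by
    refine Set.Icc_subset_Icc (fun _ => ?_) le_rfl
    show -(x : ℝ) ≤ 1
    linarith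
  have hb := hN₀ x hx₀ Ψ hnd haff K hKc hKB
  rw [hsing] at hb
  have hZ0 : 0 ≤ (x : ℝ) ^ ((1 : ℝ) / u) := Real.rpow_nonneg (Nat.cast_nonneg x) _
  -- assemble
  rw [Pi.sub_apply, Real.norm_eq_abs, Real.norm_eq_abs, hcount]
  refine le_trans ?_ (mul_le_mul_of_nonneg_right hδδ₀ (abs_nonneg _))
  refine hl_arith H.card hb (card_cells_le_primePointCount x _ Ψ K)
    (primePointCount_le_card_cells_add hZ0 Ψ hnd K) hx0' hlog hs hδ hδ1 hε0.le hε2 ?_ ?_ hβ2 ?_ ?_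
  · -- the error count
    have h := errCount_mul_log_pow_le (k := H.card) hx1' hu hlog1 hlogk
    have h3 : 3 * (H.card : ℝ) * c * x = δ / 8 * (s * x) := by
      rw [hcdef]; field_simp; ring
    rw [h3] at h
    exact h
  · linarith
  · refine hηlo.trans (pow_le_pow_left₀ (by linarith) ?_ _)
    exact (roughDensity_window hxwin hx1 hu).1
  · refine le_trans (pow_le_pow_left₀ ?_ ?_ _) hηup
    · exact mul_nonneg (div_nonneg (Nat.cast_nonneg _) (Nat.cast_nonneg _)) hlog.le
    · exact (roughDensity_window hxwin hx1 hu).2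

/-! ### Corollaries: the `Li` form, the sibling nodes and the summit -/

/-- The crux implies the prime `k`-tuples conjecture in Hardy–Littlewood's own `Li_k` form
(Theorem X 1 verbatim), via the tree's `hardyLittlewoodTuples_iff_li_holds`.
[cite: HardyLittlewoodPN3, Theorem X 1 (5.663)–(5.664) p. 61] -/
theorem primeCellsRelative_implies_hardyLittlewoodTuplesLi (hP : PrimeCellsRelative) :
    HardyLittlewoodTuplesLi :=
  (show HardyLittlewoodTuples ↔ HardyLittlewoodTuplesLi from hardyLittlewoodTuples_iff_li_holds).mp
    (primeCellsRelative_implies_hardyLittlewoodTuples hP)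

/-- `RelativeDimOne` (stmt-Parity-14113) implies the prime `k`-tuples conjecture, through the landed
up-transfer `primeCellsRelative_of_relativeDimOne`. [cite: GreenTao2010, Conj. 1.4] -/
theorem relativeDimOne_implies_hardyLittlewoodTuples (hR : RelativeDimOne) : HardyLittlewoodTuples :=
  primeCellsRelative_implies_hardyLittlewoodTuples (primeCellsRelative_of_relativeDimOne hR)

/-- `DimOne` (stmt-Parity-0819, Green–Tao Conj. 1.2 at `d = 1`) implies the prime `k`-tuples
conjecture. [cite: GreenTao2010, Conj. 1.2] -/
theorem dimOne_implies_hardyLittlewoodTuples (hD : DimOne) : HardyLittlewoodTuples :=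
  primeCellsRelative_implies_hardyLittlewoodTuples (primeCellsRelative_of_dimOne hD)

/-- **The summit conjunct implies the Hardy–Littlewood prime `k`-tuples conjecture**: Green–Tao's
generalised Hardy–Littlewood conjecture (all complexities) contains parity.S01 — the case `d = 1` of
the translate systems, in counting form. [cite: GreenTao2010, Conj. 1.2 and Conj. 1.4] -/
theorem generalizedHardyLittlewood_implies_hardyLittlewoodTuples
    (hG : _root_.GeneralizedHardyLittlewood) : HardyLittlewoodTuples :=
  primeCellsRelative_implies_hardyLittlewoodTuples (primeCellsRelative_of_generalizedHardyLittlewood hG)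

end Summit.Parity.GeneralizedHardyLittlewood.Cruxes.PrimeCellsRelative.Sketch

end
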